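import Mathlib.RingTheory.Kaehler.Basic
import Mathlib.RingTheory.LocalRing.MaximalIdeal.Basic
import Mathlib.LinearAlgebra.Quotient.Basic
import Mathlib.LinearAlgebra.Finsupp.LinearCombination
import Mathlib.RingTheory.Ideal.Operations
import Mathlib.Algebra.BigOperators.Pi
import HarnessLib

/-!
# Logarithmic differentials `Ω¹_A(log D)` along `D = V(z₁ ⋯ z_n)` and their fibre at the closed point

Topic: `Literature/AlgebraicGeometry/Ramification` (support for `KatoCleanRamification.lean`,
definition request `defn-KatoCleanRamification`). The sheaf `Ω¹_X(log D)` of differential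
1-forms with logarithmic poles along a (strict) normal crossings divisor `D` is, at a point `x`
where `D = V(z₁ ⋯ z_n)` with `z₁, …, z_n` part of a regular system of parameters of
`A = 𝒪_{X,x}`, the `A`-module generated by `Ω¹_A` and symbols `dlog zᵢ` subject to
`zᵢ · dlog zᵢ = dzᵢ`. We take the ABSOLUTE Kähler differentials `Ω¹_{A/ℤ}` (Kato's convention;
for `A` of characteristic `p` essentially of finite type over a perfect field `k` this is
`Ω¹_{A/k} = Ω¹_{A/A^p}`, Yatagawa 2022 §1.1, since `Ω¹_{k/𝔽_p} = 0`), and render the printed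
presentation (Kato 1989 §2 / Abbes–Saito 2011 §1.10 `Ω¹_{𝒪_K}(log) = (Ω¹_{𝒪_K} ⊕ (𝒪_K ⊗ K^×))/B`,
`B` generated by `(da, 0) - (0, a ⊗ a)`; Yatagawa 2022 p. 9) for the finitely many equations
`zᵢ`:

  `LogDifferential A z = (Ω[A⁄ℤ] × (Fin n → A)) ⧸ ⟨(d zᵢ, -zᵢ eᵢ) | i⟩`, `dlog zᵢ = [(0, eᵢ)]`.

No regularity hypothesis is built in (for `z` part of a regular system of parameters of a
regular local ring essentially smooth over a perfect field this module is free with basis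
`dlog z₁, …, dlog z_n, dy₁, …`; we do not prove or use freeness).

## Content

* `logRelations A z`, `LogDifferential A z` (an `A`-module), `LogDifferential.mk`, `ofKaehler`,
  `dlog`, the derivation `LogDifferential.d : Derivation ℤ A (LogDifferential A z)` and the
  defining relation `d_apply_z : d (z i) = z i • dlog i`.
* THE FIBRE CRITERION `mk_mem_smul_top_iff` (PROVED): for an ideal `I ∋ z₁, …, z_n` (the maximal
  ideal of a local `A`), `[(ω, c)] ∈ I · Ω¹_A(log D)` iff every `cᵢ ∈ I` and
  `ω ∈ I · Ω¹_A + Σᵢ A dzᵢ`. With `I = 𝔪_x` this computes the fibre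
  `Ω¹_A(log D) ⊗ κ(x) = (Ω¹_A ⊗ κ(x))/⟨dzᵢ⟩ ⊕ ⊕ᵢ κ(x) dlog zᵢ`, which is how the (non)vanishing of a
  refined Swan conductor at `x` is tested (`KatoCleanRamification.lean`).

## Sources

* K. Kato, *Swan conductors for characters of degree one in the imperfect residue field case*,
  Contemp. Math. 83 (1989), §2. [Kato1989]
* A. Abbes, T. Saito, *Ramification and cleanliness*, Tohoku Math. J. 63 (2011), §1.10
  (`Ω¹_{𝒪_K}(log)`, `Ω¹_F(log)`). [AbbesSaito2011]
* Y. Yatagawa, arXiv:2206.02989 (2022), §1.1 p. 9 (the presentation of `Ω¹_{𝒪_K}(log)`), §1.2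
  (`Ω¹_X(log D)(R)`). [Yatagawa2022]
-/

noncomputable section

namespace Literature.AlgebraicGeometry.Ramification

universe u

open IsLocalRing

variable (A : Type u) [CommRing A] {n : ℕ} (z : Fin n → A)

/-- The relations `(d zᵢ, 0) - (0, zᵢ · eᵢ)`, i.e. `dzᵢ = zᵢ · dlog zᵢ`, presenting the
logarithmic differentials along `V(z₁ ⋯ z_n)` (Yatagawa 2022 p. 9: `B` generated by
`(da, 0) - (0, a ⊗ a)`). [cite: Yatagawa2022, §1.1 p. 9] -/
def logRelations : Submodule A (Ω[A⁄ℤ] × (Fin n → A)) :=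
  Submodule.span A (Set.range fun i : Fin n => (KaehlerDifferential.D ℤ A (z i), -Pi.single i (z i)))

/-- **Logarithmic differentials** `Ω¹_A(log D)`, `D = V(z₁ ⋯ z_n)`: the `A`-module
`(Ω¹_{A/ℤ} ⊕ ⊕ᵢ A·eᵢ)/⟨dzᵢ - zᵢ eᵢ⟩`, `eᵢ = dlog zᵢ` — the stalk at a point of Kato's `Ω¹_X(log D)`
when `A = 𝒪_{X,x}` and the `zᵢ` are local equations of the branches of `D` at `x`
(Kato 1989 §2; Abbes–Saito 2011 §1.10; Yatagawa 2022 §1.1–1.2). [cite: AbbesSaito2011, §1.10] -/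
abbrev LogDifferential : Type u :=
  (Ω[A⁄ℤ] × (Fin n → A)) ⧸ logRelations A z

namespace LogDifferential

/-- The quotient map from the presentation `Ω¹_A × Aⁿ`. [folklore] -/
def mk : (Ω[A⁄ℤ] × (Fin n → A)) →ₗ[A] LogDifferential A z :=
  (logRelations A z).mkQ

/-- The natural map `Ω¹_A → Ω¹_A(log D)`. [folklore] -/
def ofKaehler : Ω[A⁄ℤ] →ₗ[A] LogDifferential A z :=
  mk A z ∘ₗ LinearMap.inl A _ _

/-- The logarithmic differential `dlog zᵢ` (class of the `i`-th basis vector). [folklore] -/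
def dlog (i : Fin n) : LogDifferential A z :=
  mk A z (0, Pi.single i 1)

/-- The universal derivation followed by `Ω¹_A → Ω¹_A(log D)`: `a ↦ da`. [folklore] -/
def d : Derivation ℤ A (LogDifferential A z) :=
  (ofKaehler A z).compDer (KaehlerDifferential.D ℤ A)

variable {A z}

/-- `mk` is surjective. [folklore] -/
theorem mk_surjective : Function.Surjective (mk A z) :=
  Submodule.mkQ_surjective _

/-- Unfolding: `d a = [(da, 0)]`. [folklore] -/
theorem d_apply (a : A) : d A z a = mk A z (KaehlerDifferential.D ℤ A a, 0) :=
  rfl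

/-- Unfolding: `ofKaehler ω = [(ω, 0)]`. [folklore] -/
theorem ofKaehler_apply (ω : Ω[A⁄ℤ]) : ofKaehler A z ω = mk A z (ω, 0) :=
  rfl

/-- Unfolding: `dlog zᵢ = [(0, eᵢ)]`. [folklore] -/
theorem dlog_def (i : Fin n) : dlog A z i = mk A z (0, Pi.single i 1) :=
  rfl

/-- The relation elements die in the quotient. [folklore] -/
theorem mk_relation (i : Fin n) :
    mk A z (KaehlerDifferential.D ℤ A (z i), -Pi.single i (z i)) = 0 := by
  rw [mk, Submodule.mkQ_apply, Submodule.Quotient.mk_eq_zero]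
  exact Submodule.subset_span ⟨i, rfl⟩

/-- **The defining relation** `d zᵢ = zᵢ · dlog zᵢ`. [cite: Yatagawa2022, §1.1 p. 9] -/
theorem d_apply_z (i : Fin n) : d A z (z i) = z i • dlog A z i := by
  have h := mk_relation (A := A) (z := z) i
  rw [show (KaehlerDifferential.D ℤ A (z i), -Pi.single i (z i)) =
      (KaehlerDifferential.D ℤ A (z i), (0 : Fin n → A)) - (z i) • ((0 : Ω[A⁄ℤ]), Pi.single i 1) by
    ext j <;> simp [Pi.single_apply], map_sub, map_smul, sub_eq_zero] at h
  rw [d_apply, dlog_def, h]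

/-- A general element: `[(ω, c)] = ofKaehler ω + Σᵢ cᵢ dlog zᵢ`. [folklore] -/
theorem mk_eq (ω : Ω[A⁄ℤ]) (c : Fin n → A) :
    mk A z (ω, c) = ofKaehler A z ω + ∑ i, c i • dlog A z i := by
  have hc : ((0 : Ω[A⁄ℤ]), c) = ∑ i, c i • ((0 : Ω[A⁄ℤ]), (Pi.single i 1 : Fin n → A)) := by
    ext j
    · simp [Prod.fst_sum]
    · simp [Prod.snd_sum, Finset.sum_apply, Pi.single_apply]
  rw [show (ω, c) = (ω, (0 : Fin n → A)) + (0, c) by simp, map_add, ofKaehler_apply, hc, map_sum]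
  simp only [map_smul, dlog_def]

/-! ## The fibre criterion -/

section Fibre

variable (I : Ideal A)

/-- Membership in `I · (M × Aⁿ)` is componentwise. [folklore] -/
theorem mem_smul_top_prod_iff (ω : Ω[A⁄ℤ]) (c : Fin n → A) :
    ((ω, c) ∈ I • (⊤ : Submodule A (Ω[A⁄ℤ] × (Fin n → A)))) ↔
      ω ∈ I • (⊤ : Submodule A Ω[A⁄ℤ]) ∧ ∀ i, c i ∈ I := by
  constructor
  · intro h
    refine ⟨?_, fun i => ?_⟩
    · have h1 : LinearMap.fst A _ _ (ω, c) ∈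
          (I • (⊤ : Submodule A (Ω[A⁄ℤ] × (Fin n → A)))).map (LinearMap.fst A _ (Fin n → A)) :=
        Submodule.mem_map_of_mem h
      rw [Submodule.map_smul''] at h1
      exact Submodule.smul_mono le_rfl le_top h1
    · have h2 : (LinearMap.proj i ∘ₗ LinearMap.snd A Ω[A⁄ℤ] (Fin n → A)) (ω, c) ∈
          (I • (⊤ : Submodule A (Ω[A⁄ℤ] × (Fin n → A)))).map
            (LinearMap.proj i ∘ₗ LinearMap.snd A Ω[A⁄ℤ] (Fin n → A)) :=
        Submodule.mem_map_of_mem h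
      rw [Submodule.map_smul''] at h2
      have h3 : c i ∈ I • (⊤ : Submodule A A) := Submodule.smul_mono le_rfl le_top h2
      simpa [Ideal.mul_top] using h3
  · rintro ⟨hω, hc⟩
    have e : (ω, c) =
        LinearMap.inl A _ _ ω + ∑ i, c i • ((0 : Ω[A⁄ℤ]), (Pi.single i 1 : Fin n → A)) := by
      ext j
      · simp [Prod.fst_sum]
      · simp [Prod.snd_sum, Finset.sum_apply, Pi.single_apply]
    rw [e]
    refine Submodule.add_mem _ ?_ (Submodule.sum_mem _ fun i _ => ?_)
    · have : (I • (⊤ : Submodule A Ω[A⁄ℤ])).map (LinearMap.inl A _ (Fin n → A)) ≤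
          I • (⊤ : Submodule A (Ω[A⁄ℤ] × (Fin n → A))) := by
        rw [Submodule.map_smul'']
        exact Submodule.smul_mono le_rfl le_top
      exact this (Submodule.mem_map_of_mem hω)
    · exact Submodule.smul_mem_smul (hc i) Submodule.mem_top

variable {I}

/-- The relations lie in `(Σ A dzᵢ) × Iⁿ` as soon as every `zᵢ ∈ I`. [folklore] -/
theorem logRelations_le_prod (hz : ∀ i, z i ∈ I) :
    logRelations A z ≤
      (Submodule.span A (Set.range fun i => KaehlerDifferential.D ℤ A (z i))).prod
        (Submodule.pi Set.univ fun _ : Fin n => (I : Submodule A A)) := by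
  rw [logRelations, Submodule.span_le]
  rintro _ ⟨i, rfl⟩
  refine ⟨Submodule.subset_span ⟨i, rfl⟩, fun j _ => ?_⟩
  simp only [Pi.neg_apply, Pi.single_apply]
  split_ifs
  · exact neg_mem (hz i)
  · simp

/-- `Σ A dzᵢ` maps into `I · Ω¹_A(log) + relations` under `ω ↦ (ω, 0)`, when `zᵢ ∈ I`:
`(dzᵢ, 0) = (dzᵢ, -zᵢeᵢ) + (0, zᵢeᵢ)`. [folklore] -/
theorem span_D_le_comap_inl (hz : ∀ i, z i ∈ I) :
    Submodule.span A (Set.range fun i => KaehlerDifferential.D ℤ A (z i)) ≤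
      (I • (⊤ : Submodule A (Ω[A⁄ℤ] × (Fin n → A))) ⊔ logRelations A z).comap
        (LinearMap.inl A _ (Fin n → A)) := by
  rw [Submodule.span_le]
  rintro _ ⟨i, rfl⟩
  rw [SetLike.mem_coe, Submodule.mem_comap, LinearMap.inl_apply,
    show (KaehlerDifferential.D ℤ A (z i), (0 : Fin n → A)) =
      ((0 : Ω[A⁄ℤ]), Pi.single i (z i)) + (KaehlerDifferential.D ℤ A (z i), -Pi.single i (z i)) by
      ext j <;> simp]
  refine Submodule.add_mem _ (Submodule.mem_sup_left ?_) (Submodule.mem_sup_right (Submodule.subset_span ⟨i, rfl⟩))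
  rw [mem_smul_top_prod_iff]
  refine ⟨Submodule.zero_mem _, fun j => ?_⟩
  simp only [Pi.single_apply]
  split_ifs
  · exact hz i
  · exact I.zero_mem

/-- **Fibre criterion.** If every `zᵢ ∈ I` then `[(ω, c)] ∈ I · Ω¹_A(log D)` iff all `cᵢ ∈ I`
and `ω ∈ I · Ω¹_A + Σᵢ A dzᵢ`. For `A` local and `I = 𝔪` this computes the fibre
`Ω¹_A(log D) ⊗ κ = (Ω¹_A ⊗ κ)/⟨dzᵢ⟩ ⊕ ⊕ᵢ κ·dlog zᵢ` at the closed point. [folklore] -/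
theorem mk_mem_smul_top_iff (hz : ∀ i, z i ∈ I) (ω : Ω[A⁄ℤ]) (c : Fin n → A) :
    mk A z (ω, c) ∈ I • (⊤ : Submodule A (LogDifferential A z)) ↔
      (∀ i, c i ∈ I) ∧
        ω ∈ I • (⊤ : Submodule A Ω[A⁄ℤ]) ⊔
          Submodule.span A (Set.range fun i => KaehlerDifferential.D ℤ A (z i)) := by
  -- `I • ⊤` of the quotient is the image of `I • ⊤`, so membership pulls back to `I • ⊤ ⊔ N`.
  have key : mk A z (ω, c) ∈ I • (⊤ : Submodule A (LogDifferential A z)) ↔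
      (ω, c) ∈ I • (⊤ : Submodule A (Ω[A⁄ℤ] × (Fin n → A))) ⊔ logRelations A z := by
    have hI : I • (⊤ : Submodule A (LogDifferential A z)) =
        (I • (⊤ : Submodule A (Ω[A⁄ℤ] × (Fin n → A)))).map (logRelations A z).mkQ := by
      rw [Submodule.map_smul'', Submodule.map_top, Submodule.range_mkQ]
    rw [hI, mk, ← Submodule.mem_comap, Submodule.comap_map_mkQ, sup_comm]
  rw [key]
  constructor
  · intro h
    -- both summands lie in `(I•Ω ⊔ span dz) × Iⁿ`
    have hle : I • (⊤ : Submodule A (Ω[A⁄ℤ] × (Fin n → A))) ⊔ logRelations A z ≤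
        (I • (⊤ : Submodule A Ω[A⁄ℤ]) ⊔
            Submodule.span A (Set.range fun i => KaehlerDifferential.D ℤ A (z i))).prod
          (Submodule.pi Set.univ fun _ : Fin n => (I : Submodule A A)) := by
      refine sup_le ?_ ((logRelations_le_prod hz).trans (Submodule.prod_mono le_sup_right le_rfl))
      rintro ⟨ω', c'⟩ h'
      rw [mem_smul_top_prod_iff] at h'
      exact ⟨Submodule.mem_sup_left h'.1, fun j _ => h'.2 j⟩
    have h' := hle h
    rw [Submodule.mem_prod, Submodule.mem_pi] at h'
    exact ⟨fun i => h'.2 i (Set.mem_univ _), h'.1⟩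
  · rintro ⟨hc, hω⟩
    obtain ⟨m, hm, s, hs, rfl⟩ := Submodule.mem_sup.mp hω
    rw [show (m + s, c) = (m, c) + (s, (0 : Fin n → A)) by simp]
    refine Submodule.add_mem _ (Submodule.mem_sup_left ?_) (span_D_le_comap_inl hz hs)
    exact (mem_smul_top_prod_iff I m c).mpr ⟨hm, hc⟩

/-- The fibre criterion for a local ring at its closed point, in terms of `ofKaehler` and
`dlog`: `ofKaehler ω + Σ cᵢ dlog zᵢ ∈ 𝔪 · Ω¹_A(log D)` iff all `cᵢ ∈ 𝔪` and
`ω ∈ 𝔪 Ω¹_A + Σ A dzᵢ`. [folklore] -/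
theorem ofKaehler_add_sum_mem_iff [IsLocalRing A] (hz : ∀ i, z i ∈ maximalIdeal A) (ω : Ω[A⁄ℤ])
    (c : Fin n → A) :
    ofKaehler A z ω + ∑ i, c i • dlog A z i ∈
        maximalIdeal A • (⊤ : Submodule A (LogDifferential A z)) ↔
      (∀ i, c i ∈ maximalIdeal A) ∧
        ω ∈ maximalIdeal A • (⊤ : Submodule A Ω[A⁄ℤ]) ⊔
          Submodule.span A (Set.range fun i => KaehlerDifferential.D ℤ A (z i)) := by
  rw [← mk_eq, mk_mem_smul_top_iff hz]

end Fibre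

end LogDifferential

end Literature.AlgebraicGeometry.Ramification

end
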